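import Mathlib.Analysis.SpecialFunctions.Pow.Real
import Mathlib.Analysis.SpecialFunctions.Sqrt
import Mathlib.Algebra.BigOperators.Ring.Finset
import Mathlib.Algebra.Order.BigOperators.Group.Finset
import Mathlib.Algebra.Order.Chebyshev
import Mathlib.Data.Fintype.Powerset
import Mathlib.Data.Fintype.Pi
import Literature.Probability.Moments.HoeffdingCounting
import HarnessLib

/-!
# Vazirani's XOR lemma (counting form) and the parallel-repetition bound it drives

For a map `c : Ω → {0,1}ʳ` on a finite sample space `Ω` (think: `ω` = a uniformly random input,
`c(ω)` = the vector of error indicators of `r` parallel attempts), write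
`χ_S(v) = Π_{i ∈ S} (-1)^{vᵢ}` for the `±1` characters of `𝔽₂ʳ` and
`bias_S = Σ_ω χ_S(c(ω))` (un-normalised). **Vazirani's XOR lemma**: if `|bias_S| ≤ ε·|Ω|` for
every non-empty `S`, then the law of `c` is `ε·√(2ʳ)/2`-close to uniform in total variation:
for every event `B ⊆ {0,1}ʳ`,

  `| #{ω : c(ω) ∈ B} − |B|·|Ω|/2ʳ | ≤ (ε·√(2ʳ)/2)·|Ω|`

(`vazirani_xor_lemma`). The proof is the usual Parseval computation
(`sum_sq_character_sum_eq`: `Σ_S (Σ_v g(v) χ_S(v))² = 2ʳ Σ_v g(v)²`, from the orthogonality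
`Σ_S χ_S(v) χ_S(w) = 2ʳ [v = w]`) followed by Cauchy–Schwarz. Combined with Hoeffding's
inequality in counting form (`Literature.Probability.Moments.hoeffding_count_pi`,
here `card_biased_strings_le`) it gives the **parallel-repetition bound** used for the
`r`-parallel search problems of Watts–Kothari–Schaeffer–Tal (2019, §6, "Vazirani's XOR lemma
[Vaz86]") and Grewal–Kumar (2024, Lemma 5.31 and Thms. 5.32/5.37): if every non-empty XOR of
the `r` error bits has bias `≤ ε|Ω|`, then at most `(exp(-2γ²r) + ε·√(2ʳ)/2)·|Ω|` sample points
have at least `(1/2 + γ)·r` correct coordinates (`card_many_correct_le`).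

Printed source for the lemma as used here: Grewal–Kumar 2024, Lemma 5.31 ("XOR lemma for finite
abelian groups", after Rao's exposition): "Let `𝒟` be a distribution over a finite abelian group
`G` such that `|E[ψ(X)]| ≤ ε` for every non-trivial character `ψ`. Then `𝒟` is `ε√|G|`-close
(in total variation distance) to the uniform distribution over `G`." We prove the case
`G = 𝔽₂ʳ` (with the constant `ε√|G|/2`).
-- TODO(general form): arbitrary finite abelian groups `G` (characters with values in `ℂ`).

## References

* S. Grewal, V. M. Kumar, *Improved circuit lower bounds and quantum-classical separations*,
  arXiv:2408.16406 (2024), Lemma 5.31, Thms. 5.32 and 5.37 [GrewalKumar2024].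
* A. Bene Watts, R. Kothari, L. Schaeffer, A. Tal, *Exponential separation between shallow quantum
  circuits and unbounded fan-in shallow classical circuits*, STOC 2019, arXiv:1906.08890, §6
  [WattsEtAl2019].
* U. Vazirani, *Randomness, adversaries and computation*, PhD thesis, UC Berkeley (1986) (the
  original XOR lemma; cited through the two sources above).
* W. Hoeffding, *Probability inequalities for sums of bounded random variables*, JASA 58 (1963),
  Thm. 2 (via `Literature.Probability.Moments.hoeffding_count_pi`).
-/

noncomputable section

namespace Literature.Computability.Complexity

open Finset Real

namespace XorLemma

open scoped Classical

variable {r : ℕ}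

/-! ### Characters of `𝔽₂ʳ` as `±1`-products -/

/-- Orthogonality of the `±1` characters of `𝔽₂ʳ`, summed over the characters:
`Σ_{S ⊆ [r]} χ_S(v) χ_S(w) = Σ_S Π_{i∈S} (-1)^{vᵢ+wᵢ} = Π_i (1 + (-1)^{vᵢ+wᵢ})` is `2ʳ` if `v = w`
and `0` otherwise. [cite: GrewalKumar2024, Lemma 5.31 (proof ingredient)] -/
theorem sum_character_mul_character (v w : Fin r → Bool) :
    ∑ S : Finset (Fin r),
        (∏ i ∈ S, (if v i then (-1 : ℝ) else 1)) * (∏ i ∈ S, (if w i then (-1 : ℝ) else 1)) =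
      if v = w then (2 : ℝ) ^ r else 0 := by
  have hprod : ∀ S : Finset (Fin r),
      (∏ i ∈ S, (if v i then (-1 : ℝ) else 1)) * (∏ i ∈ S, (if w i then (-1 : ℝ) else 1)) =
        ∏ i ∈ S, (if v i = w i then (1 : ℝ) else -1) := by
    intro S
    rw [← Finset.prod_mul_distrib]
    refine Finset.prod_congr rfl fun i _ => ?_
    cases v i <;> cases w i <;> norm_num
  simp_rw [hprod]
  -- `Σ_S Π_{i ∈ S} s_i = Π_i (1 + s_i)`
  rw [← Finset.powerset_univ, ← Finset.prod_one_add]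
  by_cases hvw : v = w
  · subst hvw
    simp only [if_true]
    norm_num
  · rw [if_neg hvw]
    have hi : ∃ i, v i ≠ w i := by
      by_contra h
      push Not at h
      exact hvw (funext h)
    obtain ⟨i, hi⟩ := hi
    exact Finset.prod_eq_zero (Finset.mem_univ i) (by rw [if_neg hi]; norm_num)

/-- **Parseval for `𝔽₂ʳ`** in the normalisation used here: for every `g : {0,1}ʳ → ℝ`,
`Σ_S (Σ_v g(v) χ_S(v))² = 2ʳ · Σ_v g(v)²`. [cite: GrewalKumar2024, Lemma 5.31 (proof ingredient)] -/
theorem sum_sq_character_sum_eq (g : (Fin r → Bool) → ℝ) :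
    ∑ S : Finset (Fin r), (∑ v, g v * ∏ i ∈ S, (if v i then (-1 : ℝ) else 1)) ^ 2 =
      (2 : ℝ) ^ r * ∑ v, g v ^ 2 := by
  calc ∑ S : Finset (Fin r), (∑ v, g v * ∏ i ∈ S, (if v i then (-1 : ℝ) else 1)) ^ 2
      = ∑ S : Finset (Fin r), ∑ v, ∑ w,
          g v * g w * ((∏ i ∈ S, (if v i then (-1 : ℝ) else 1)) *
            ∏ i ∈ S, (if w i then (-1 : ℝ) else 1)) := by
        refine Finset.sum_congr rfl fun S _ => ?_
        rw [sq, Finset.sum_mul_sum]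
        refine Finset.sum_congr rfl fun v _ => Finset.sum_congr rfl fun w _ => ?_
        ring
    _ = ∑ v, ∑ w, g v * g w * ∑ S : Finset (Fin r),
          ((∏ i ∈ S, (if v i then (-1 : ℝ) else 1)) *
            ∏ i ∈ S, (if w i then (-1 : ℝ) else 1)) := by
        rw [Finset.sum_comm]
        refine Finset.sum_congr rfl fun v _ => ?_
        rw [Finset.sum_comm]
        refine Finset.sum_congr rfl fun w _ => ?_
        rw [Finset.mul_sum]
    _ = ∑ v, ∑ w, g v * g w * (if v = w then (2 : ℝ) ^ r else 0) := by
        simp_rw [sum_character_mul_character]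
    _ = (2 : ℝ) ^ r * ∑ v, g v ^ 2 := by
        simp only [mul_ite, mul_zero, Finset.sum_ite_eq, Finset.mem_univ, if_true]
        rw [Finset.mul_sum]
        refine Finset.sum_congr rfl fun v _ => ?_
        ring

/-- A non-trivial character sums to zero over the group: `Σ_v χ_S(v) = 0` for `S ≠ ∅`
(`Σ_v Π_{i∈S} (-1)^{vᵢ} = Π_{i ∈ S} ((-1) + 1) · 2^{r - |S|}`).
[cite: GrewalKumar2024, Lemma 5.31 (proof ingredient)] -/
theorem sum_character_eq_zero {S : Finset (Fin r)} (hS : S.Nonempty) :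
    ∑ v : Fin r → Bool, ∏ i ∈ S, (if v i then (-1 : ℝ) else 1) = 0 := by
  obtain ⟨i₀, hi₀⟩ := hS
  have hrw : ∀ v : Fin r → Bool, ∏ i ∈ S, (if v i then (-1 : ℝ) else 1) =
      ∏ i, (if i ∈ S then (if v i then (-1 : ℝ) else 1) else 1) := by
    intro v
    rw [Finset.prod_ite_mem, Finset.univ_inter]
  simp_rw [hrw]
  have h := Finset.prod_univ_sum (fun _ : Fin r => (univ : Finset Bool))
    (fun i b => if i ∈ S then (if b then (-1 : ℝ) else 1) else 1)
  rw [Fintype.piFinset_univ] at h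
  rw [← h]
  refine Finset.prod_eq_zero (Finset.mem_univ i₀) ?_
  simp [hi₀]

/-- Sums over the sample space are sums over the fibres of `c`:
`Σ_ω f(c(ω)) = Σ_v #{c = v} · f(v)`. [folklore] -/
private theorem sum_comp_eq_sum_fiber {Ω : Type*} [Fintype Ω] (c : Ω → Fin r → Bool)
    (f : (Fin r → Bool) → ℝ) :
    ∑ ω, f (c ω) = ∑ v, ((univ.filter fun ω => c ω = v).card : ℝ) * f v := by
  rw [← Finset.sum_fiberwise_of_maps_to (s := (univ : Finset Ω))
    (t := (univ : Finset (Fin r → Bool))) (g := c) (fun _ _ => Finset.mem_univ _)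
    (f := fun ω => f (c ω))]
  refine Finset.sum_congr rfl fun v _ => ?_
  rw [Finset.sum_congr rfl fun ω hω => by rw [(Finset.mem_filter.1 hω).2], Finset.sum_const,
    nsmul_eq_mul]

/-! ### The XOR lemma -/

/-- **Vazirani's XOR lemma, counting form on `𝔽₂ʳ`** (Grewal–Kumar 2024, Lemma 5.31, case
`G = 𝔽₂ʳ`; Watts–Kothari–Schaeffer–Tal 2019, §6 [Vaz86]): let `c : Ω → {0,1}ʳ` on a finite
sample space and suppose every non-empty XOR is nearly unbiased,
`|Σ_ω Π_{i∈S} (-1)^{c(ω)ᵢ}| ≤ ε·|Ω|` for all `S ≠ ∅` (`ε ≥ 0`). Then for every event `B ⊆ {0,1}ʳ`,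
`|#{ω : c(ω) ∈ B} − |B|·|Ω|/2ʳ| ≤ (ε·√(2ʳ)/2)·|Ω|`, i.e. the law of `c(ω)` (for `ω` uniform) is
within `ε√(2ʳ)/2` of uniform in total variation. (Parseval: the centred fibre counts
`δ_v = #{c = v} − |Ω|/2ʳ` have `2ʳ Σ_v δ_v² = Σ_{S ≠ ∅} bias_S² ≤ 2ʳ ε²|Ω|²`; Cauchy–Schwarz:
`Σ_v |δ_v| ≤ √(2ʳ)·ε|Ω|`; and `2|Σ_{v∈B} δ_v| ≤ Σ_v |δ_v|` since `Σ_v δ_v = 0`.)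
[cite: GrewalKumar2024, Lemma 5.31] -/
theorem vazirani_xor_lemma {Ω : Type*} [Fintype Ω] (c : Ω → Fin r → Bool) {ε : ℝ} (hε : 0 ≤ ε)
    (hbias : ∀ S : Finset (Fin r), S.Nonempty →
      |∑ ω, ∏ i ∈ S, (if c ω i then (-1 : ℝ) else 1)| ≤ ε * Fintype.card Ω)
    (B : Finset (Fin r → Bool)) :
    |((univ.filter fun ω => c ω ∈ B).card : ℝ) - B.card * Fintype.card Ω / 2 ^ r| ≤
      ε * Real.sqrt (2 ^ r) / 2 * Fintype.card Ω := by
  set N : ℝ := (Fintype.card Ω : ℝ) with hN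
  have hN0 : 0 ≤ N := by rw [hN]; positivity
  -- fibre counts `μ` and centred fibre counts `δ`
  set μ : (Fin r → Bool) → ℝ := fun v => ((univ.filter fun ω => c ω = v).card : ℝ) with hμ
  set δ : (Fin r → Bool) → ℝ := fun v => μ v - N / 2 ^ r with hδ
  have hcardV : (Fintype.card (Fin r → Bool) : ℝ) = 2 ^ r := by simp
  have h2r : (0 : ℝ) < 2 ^ r := by positivity
  -- `Σ_v μ_v = N`, `Σ_v δ_v = 0`
  have hμsum : ∑ v, μ v = N := by
    have h := sum_comp_eq_sum_fiber c (fun _ => (1 : ℝ))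
    simp only [mul_one, Finset.sum_const, Finset.card_univ, nsmul_eq_mul] at h
    rw [hN, ← h]
  have hδsum : ∑ v, δ v = 0 := by
    simp only [hδ, Finset.sum_sub_distrib, hμsum, Finset.sum_const, Finset.card_univ,
      nsmul_eq_mul, hcardV]
    field_simp
    ring
  -- the squared biases of `δ`
  have hδbias : ∀ S : Finset (Fin r),
      (∑ v, δ v * ∏ i ∈ S, (if v i then (-1 : ℝ) else 1)) ^ 2 ≤ (ε * N) ^ 2 := by
    intro S
    rcases S.eq_empty_or_nonempty with hS | hS
    · subst hS
      have h0 : ∑ v, δ v * ∏ i ∈ (∅ : Finset (Fin r)), (if v i then (-1 : ℝ) else 1) = 0 := by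
        simp only [Finset.prod_empty, mul_one]
        exact hδsum
      rw [h0, zero_pow two_ne_zero]
      positivity
    · have hrw : ∑ v, δ v * ∏ i ∈ S, (if v i then (-1 : ℝ) else 1) =
          ∑ ω, ∏ i ∈ S, (if c ω i then (-1 : ℝ) else 1) := by
        simp only [hδ, sub_mul, Finset.sum_sub_distrib]
        rw [← Finset.mul_sum, sum_character_eq_zero hS, mul_zero, sub_zero,
          sum_comp_eq_sum_fiber c (fun v => ∏ i ∈ S, (if v i then (-1 : ℝ) else 1))]
      rw [hrw]
      have h := hbias S hS
      have habs := abs_le.1 h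
      have hεN : 0 ≤ ε * N := mul_nonneg hε hN0
      nlinarith [habs.1, habs.2]
  -- Parseval: `2ʳ Σ δ² = Σ_S bias_S(δ)² ≤ 2ʳ (εN)²`
  have hδsq : ∑ v, δ v ^ 2 ≤ (ε * N) ^ 2 := by
    have hpar := sum_sq_character_sum_eq δ
    have hle : ∑ S : Finset (Fin r), (∑ v, δ v * ∏ i ∈ S, (if v i then (-1 : ℝ) else 1)) ^ 2 ≤
        ∑ _S : Finset (Fin r), (ε * N) ^ 2 := Finset.sum_le_sum fun S _ => hδbias S
    rw [hpar, Finset.sum_const, Finset.card_univ, nsmul_eq_mul] at hle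
    have hcardS : (Fintype.card (Finset (Fin r)) : ℝ) = 2 ^ r := by
      rw [Fintype.card_finset]; simp
    rw [hcardS] at hle
    exact le_of_mul_le_mul_left hle h2r
  -- Cauchy–Schwarz: `Σ |δ| ≤ √(2ʳ) ε N`
  have hl1 : ∑ v, |δ v| ≤ Real.sqrt (2 ^ r) * (ε * N) := by
    have hcs := Finset.sum_mul_sq_le_sq_mul_sq (univ : Finset (Fin r → Bool))
      (fun v => |δ v|) (fun _ => (1 : ℝ))
    simp only [mul_one, one_pow, Finset.sum_const, Finset.card_univ, nsmul_eq_mul, hcardV,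
      sq_abs] at hcs
    have h1 : (∑ v, |δ v|) ^ 2 ≤ (Real.sqrt (2 ^ r) * (ε * N)) ^ 2 := by
      rw [mul_pow, Real.sq_sqrt h2r.le]
      calc (∑ v, |δ v|) ^ 2 ≤ (∑ v, δ v ^ 2) * 2 ^ r := by simpa [mul_comm] using hcs
        _ ≤ (ε * N) ^ 2 * 2 ^ r := mul_le_mul_of_nonneg_right hδsq h2r.le
        _ = 2 ^ r * (ε * N) ^ 2 := mul_comm _ _
    have hnn : 0 ≤ Real.sqrt (2 ^ r) * (ε * N) := by positivity
    exact (pow_le_pow_iff_left₀ (Finset.sum_nonneg fun v _ => abs_nonneg _) hnn two_ne_zero).1 h1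
  -- the event `B`: `#{c ∈ B} - |B| N / 2ʳ = Σ_{v ∈ B} δ_v`
  have hB : ((univ.filter fun ω => c ω ∈ B).card : ℝ) - B.card * N / 2 ^ r = ∑ v ∈ B, δ v := by
    have h := sum_comp_eq_sum_fiber c (fun v => if v ∈ B then (1 : ℝ) else 0)
    have hL : ∑ ω, (if c ω ∈ B then (1 : ℝ) else 0) = ((univ.filter fun ω => c ω ∈ B).card : ℝ) := by
      simp [Finset.sum_boole]
    rw [hL] at h
    rw [h]
    simp only [mul_ite, mul_one, mul_zero, Finset.sum_ite_mem, Finset.univ_inter, hδ,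
      Finset.sum_sub_distrib, Finset.sum_const, nsmul_eq_mul]
    ring
  have hBc : ∑ v ∈ B, δ v + ∑ v ∈ Bᶜ, δ v = 0 := by
    rw [Finset.sum_add_sum_compl, hδsum]
  have hsplit : ∑ v ∈ B, |δ v| + ∑ v ∈ Bᶜ, |δ v| = ∑ v, |δ v| := Finset.sum_add_sum_compl _ _
  have h1 : |∑ v ∈ B, δ v| ≤ ∑ v ∈ B, |δ v| := Finset.abs_sum_le_sum_abs _ _
  have h2 : |∑ v ∈ Bᶜ, δ v| ≤ ∑ v ∈ Bᶜ, |δ v| := Finset.abs_sum_le_sum_abs _ _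
  have h3 : |∑ v ∈ Bᶜ, δ v| = |∑ v ∈ B, δ v| := by
    rw [show ∑ v ∈ Bᶜ, δ v = -∑ v ∈ B, δ v by linarith, abs_neg]
  rw [hB]
  have : 2 * |∑ v ∈ B, δ v| ≤ Real.sqrt (2 ^ r) * (ε * N) := by linarith
  linarith

/-! ### Parallel repetition: many correct coordinates are rare -/

/-- **Hoeffding for fair coins, counting form**: among the `2ʳ` strings `v ∈ {0,1}ʳ`, at most
`exp(-2γ²r)·2ʳ` have at least `(1/2 + γ)·r` coordinates equal to a fixed bit `b₀` (Hoeffding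
1963, Thm. 2, via `Literature.Probability.Moments.hoeffding_count_pi` with `f_i = ±1/2`).
[cite: GrewalKumar2024, Thm. 5.37 (proof: "By a Chernoff bound")] -/
theorem card_biased_strings_le (r : ℕ) {γ : ℝ} (hγ : 0 ≤ γ) (b₀ : Bool) :
    ((univ.filter fun v : Fin r → Bool =>
        (1 / 2 + γ) * r ≤ ((univ.filter fun i => v i = b₀).card : ℝ)).card : ℝ) ≤
      Real.exp (-(2 * γ ^ 2 * r)) * 2 ^ r := by
  rcases Nat.eq_zero_or_pos r with hr | hr
  · subst hr
    refine le_trans (b := (1 : ℝ)) ?_ (by simp)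
    have h := Finset.card_le_univ (univ.filter fun v : Fin 0 → Bool =>
      (1 / 2 + γ) * ((0 : ℕ) : ℝ) ≤ ((univ.filter fun i => v i = b₀).card : ℝ))
    have hc : Fintype.card (Fin 0 → Bool) = 1 := by simp
    exact_mod_cast h.trans hc.le
  · have hf0 : ∀ _i : Fin r, ∑ b : Bool, (if b = b₀ then (1 / 2 : ℝ) else -(1 / 2)) = 0 := by
      intro _
      cases b₀ <;> simp
    have hfc : ∀ (_i : Fin r) (b : Bool),
        |(if b = b₀ then (1 / 2 : ℝ) else -(1 / 2))| ≤ 1 / 2 := by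
      intro _ b
      split <;> norm_num
    have hSpos : (0 : ℝ) < ∑ _i : Fin r, (1 / 2 : ℝ) ^ 2 := by
      simp only [Finset.sum_const, Finset.card_univ, Fintype.card_fin, nsmul_eq_mul]
      have : (0 : ℝ) < r := by exact_mod_cast hr
      positivity
    have hmain := Literature.Probability.Moments.hoeffding_count_pi (ι := Fin r)
      (κ := fun _ => Bool) (fun _ b => if b = b₀ then (1 / 2 : ℝ) else -(1 / 2))
      (fun _ => (1 / 2 : ℝ)) hf0 hfc (t := γ * r) (by positivity) hSpos
    -- rewrite the event and the constants
    have hsum : ∀ v : Fin r → Bool,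
        ∑ i, (if v i = b₀ then (1 / 2 : ℝ) else -(1 / 2)) =
          ((univ.filter fun i => v i = b₀).card : ℝ) - r / 2 := by
      intro v
      have h1 : ∑ i, (if v i = b₀ then (1 / 2 : ℝ) else -(1 / 2)) =
          ∑ i, ((if v i = b₀ then (1 : ℝ) else 0) - 1 / 2) := by
        refine Finset.sum_congr rfl fun i _ => ?_
        split <;> norm_num
      rw [h1, Finset.sum_sub_distrib, Finset.sum_boole, Finset.sum_const, Finset.card_univ,
        Fintype.card_fin, nsmul_eq_mul]
      ring
    have hevt : (univ.filter fun v : Fin r → Bool =>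
        (1 / 2 + γ) * r ≤ ((univ.filter fun i => v i = b₀).card : ℝ)) =
        univ.filter fun v : Fin r → Bool =>
          γ * r ≤ ∑ i, (if v i = b₀ then (1 / 2 : ℝ) else -(1 / 2)) := by
      refine Finset.filter_congr fun v _ => ?_
      rw [hsum v]
      constructor <;> intro h <;> linarith
    have hconst : Real.exp (-((γ * r) ^ 2 / (2 * ∑ _i : Fin r, (1 / 2 : ℝ) ^ 2))) =
        Real.exp (-(2 * γ ^ 2 * r)) := by
      congr 1
      simp only [Finset.sum_const, Finset.card_univ, Fintype.card_fin, nsmul_eq_mul]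
      have hr' : (0 : ℝ) < r := by exact_mod_cast hr
      rw [neg_inj, div_eq_iff (by positivity)]
      ring
    have hprod : ∏ _i : Fin r, (Fintype.card Bool : ℝ) = 2 ^ r := by simp
    rw [hevt]
    rw [hconst, hprod] at hmain
    exact hmain

/-- **Parallel-repetition bound from the XOR lemma** (the combinatorial core of Grewal–Kumar
2024, Thms. 5.32/5.37 and Watts–Kothari–Schaeffer–Tal 2019, §6): let `c : Ω → {0,1}ʳ` record
which of `r` parallel attempts ERR (`c(ω)ᵢ = 1` iff attempt `i` is wrong on sample point `ω`).
If every non-empty XOR of the error bits is nearly unbiased, `|Σ_ω Π_{i∈S}(-1)^{c(ω)ᵢ}| ≤ ε|Ω|`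
(`S ≠ ∅`), then the number of sample points with at least `(1/2 + γ)·r` CORRECT attempts is at
most `(exp(-2γ²r) + ε·√(2ʳ)/2)·|Ω|`. [cite: GrewalKumar2024, Thm. 5.37 (proof)] -/
theorem card_many_correct_le {Ω : Type*} [Fintype Ω] (c : Ω → Fin r → Bool) {ε γ : ℝ}
    (hε : 0 ≤ ε) (hγ : 0 ≤ γ)
    (hbias : ∀ S : Finset (Fin r), S.Nonempty →
      |∑ ω, ∏ i ∈ S, (if c ω i then (-1 : ℝ) else 1)| ≤ ε * Fintype.card Ω) :
    ((univ.filter fun ω =>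
        (1 / 2 + γ) * r ≤ ((univ.filter fun i => c ω i = false).card : ℝ)).card : ℝ) ≤
      (Real.exp (-(2 * γ ^ 2 * r)) + ε * Real.sqrt (2 ^ r) / 2) * Fintype.card Ω := by
  set N : ℝ := (Fintype.card Ω : ℝ) with hN
  have hN0 : 0 ≤ N := by rw [hN]; positivity
  set B : Finset (Fin r → Bool) := univ.filter fun v : Fin r → Bool =>
    (1 / 2 + γ) * r ≤ ((univ.filter fun i => v i = false).card : ℝ) with hBdef
  have hevt : (univ.filter fun ω =>
      (1 / 2 + γ) * r ≤ ((univ.filter fun i => c ω i = false).card : ℝ)) =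
      univ.filter fun ω => c ω ∈ B := by
    refine Finset.filter_congr fun ω _ => ?_
    rw [hBdef, Finset.mem_filter]
    simp
  rw [hevt]
  have hx := vazirani_xor_lemma c hε hbias B
  have hBcard : (B.card : ℝ) ≤ Real.exp (-(2 * γ ^ 2 * r)) * 2 ^ r :=
    card_biased_strings_le r hγ false
  have h2r : (0 : ℝ) < 2 ^ r := by positivity
  have h1 : (B.card : ℝ) * N / 2 ^ r ≤ Real.exp (-(2 * γ ^ 2 * r)) * N := by
    rw [div_le_iff₀ h2r]
    calc (B.card : ℝ) * N ≤ Real.exp (-(2 * γ ^ 2 * r)) * 2 ^ r * N :=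
          mul_le_mul_of_nonneg_right hBcard hN0
      _ = Real.exp (-(2 * γ ^ 2 * r)) * N * 2 ^ r := by ring
  have h2 := (abs_le.1 hx).2
  linarith

end XorLemma

end Literature.Computability.Complexity
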